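import Mathlib
import HarnessLib

/-!
# Venture HSemireg — the four-level vanishing lemma (every word of length four in a pencil element and conormal vectors is zero)

HONEST FRAMING. Lean leaf for the computation cell `pub-hsemireg` (target seat t-5 gen 20; file of record
`run/shared/lean/pub/pub-hsemireg/target-g6/EXP-PENCILS-t5g20.md`). Setting of the fibre test for reduced-point
complexes (TH3-SIGMA-ORBIT-PROOF §1): a graded space `M = M₀ ⊕ M₁ ⊕ ⋯ ⊕ M_m`, an odd operator `x = u(s)` of degree
`+1` (a pencil element) and *conormal vectors* `y, z, w` — odd operators of degree `-1` with `x y + y x = 0` (the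
potential values `V(s)` of (E1)-classes are such). All of these live in the ring `R = End(M)`.

THE LEMMA (t-5 g20, EXP-PENCILS §0 / NOTES «4-level vanishing lemma»): **at four levels (`m = 3`) every word of
length four in `x` and conormal letters vanishes** — `x x y z = 0`, `x y z x = 0`, `y z x x = 0`, `x x x y = 0`,
`x y z w = 0`, … . Proof: anticommuting the `x`'s through, each such word `W` equals `±` the same letters with all
`x`'s moved to the other end; the two forms annihilate complementary groups of levels (two degree-`-1` letters applied
first kill `M₀ ⊕ M₁`, two degree-`+1` letters applied first kill `M₂ ⊕ M₃`), so `W = W·(e+f) = 0`. This is the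
elementary core of the statement «the preprojective algebra `Π(A₄)` has Loewy length four», which is the finite-type
input that makes the four-level laws of the cell ((NV), (QT)₄, (TAN-s)₄, …) special; at five levels the supports
overlap and the words survive (EXP-PENCILS §0, probe_loewy.py: `x²y z|_{M₂} = y z x²|_{M₂} ≠ 0` on the cones).

ENCODING. `R` is any ring (think `End(M)`); the level bookkeeping is abstracted into two complementary elements
`e + f = 1` (think `e = π₀ + π₁`, `f = π₂ + π₃`, or the analogous splits) together with the two support facts that
hold at four levels: `y z e = 0` (two down-steps kill the two bottom levels) and `x x f = 0` (two up-steps kill the two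
top levels); for the `x³y` words `e = π₀`, `f = π₁+π₂+π₃` with `y e = 0`, `x x x f = 0`; for the `x y z w` words
`e = π₀+π₁+π₂`, `f = π₃` with `y z w e = 0`, `x f = 0`. No idempotency or centrality of `e, f` is needed.
Nothing here constructs an object or bears on HC, HC_CM or HC_AV.
-/

namespace Summit.Ventures.HSemireg

section TwoUpTwoDown

variable {R : Type*} [Ring R] (x y z e f : R)

/-- **Four-level vanishing, master case `x x y z = 0`.** `x` anticommutes with the conormal letters `y`, `z`;
`e + f = 1` with `y z e = 0` (two down-steps kill the bottom two levels) and `x x f = 0` (two up-steps kill the top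
two levels). Then `x x y z = 0`. [folklore] -/
theorem fourLevel_xxyz_eq_zero (hxy : x * y = -(y * x)) (hxz : x * z = -(z * x))
    (hef : e + f = 1) (hyz : y * z * e = 0) (hxx : x * x * f = 0) : x * x * y * z = 0 := by
  -- move both x's to the right: x x y z = y z x x
  have hswap : x * x * y * z = y * z * (x * x) := by
    calc x * x * y * z = x * (x * y) * z := by noncomm_ring
      _ = x * (-(y * x)) * z := by rw [hxy]
      _ = -((x * y) * (x * z)) := by noncomm_ring
      _ = -((-(y * x)) * (-(z * x))) := by rw [hxy, hxz]
      _ = -(y * (x * z) * x) := by noncomm_ring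
      _ = -(y * (-(z * x)) * x) := by rw [hxz]
      _ = y * z * (x * x) := by noncomm_ring
  calc x * x * y * z = x * x * y * z * (e + f) := by rw [hef, mul_one]
    _ = x * x * (y * z * e) + (x * x * y * z) * f := by noncomm_ring
    _ = x * x * (y * z * e) + y * z * (x * x * f) := by rw [hswap]; noncomm_ring
    _ = 0 := by rw [hyz, hxx]; simp

/-- The ordering `x y x z` (same hypotheses): `x y x z = -(x x y z) = 0`. [folklore] -/
theorem fourLevel_xyxz_eq_zero (hxy : x * y = -(y * x)) (hxz : x * z = -(z * x))
    (hef : e + f = 1) (hyz : y * z * e = 0) (hxx : x * x * f = 0) : x * y * x * z = 0 := by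
  have h := fourLevel_xxyz_eq_zero x y z e f hxy hxz hef hyz hxx
  have hyx : y * x = -(x * y) := by rw [hxy, neg_neg]
  calc x * y * x * z = x * (y * x) * z := by noncomm_ring
    _ = x * (-(x * y)) * z := by rw [hyx]
    _ = -(x * x * y * z) := by noncomm_ring
    _ = 0 := by rw [h]; simp

/-- The ordering `x y z x` (same hypotheses): `x y z x = x x y z = 0`. [folklore] -/
theorem fourLevel_xyzx_eq_zero (hxy : x * y = -(y * x)) (hxz : x * z = -(z * x))
    (hef : e + f = 1) (hyz : y * z * e = 0) (hxx : x * x * f = 0) : x * y * z * x = 0 := by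
  have h := fourLevel_xyxz_eq_zero x y z e f hxy hxz hef hyz hxx
  have hzx : z * x = -(x * z) := by rw [hxz, neg_neg]
  calc x * y * z * x = x * y * (z * x) := by noncomm_ring
    _ = x * y * (-(x * z)) := by rw [hzx]
    _ = -(x * y * x * z) := by noncomm_ring
    _ = 0 := by rw [h]; simp

/-- The ordering `y x x z` (same hypotheses). [folklore] -/
theorem fourLevel_yxxz_eq_zero (hxy : x * y = -(y * x)) (hxz : x * z = -(z * x))
    (hef : e + f = 1) (hyz : y * z * e = 0) (hxx : x * x * f = 0) : y * x * x * z = 0 := by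
  have h := fourLevel_xyxz_eq_zero x y z e f hxy hxz hef hyz hxx
  have hyx : y * x = -(x * y) := by rw [hxy, neg_neg]
  calc y * x * x * z = (y * x) * x * z := by noncomm_ring
    _ = (-(x * y)) * x * z := by rw [hyx]
    _ = -(x * y * x * z) := by noncomm_ring
    _ = 0 := by rw [h]; simp

/-- The ordering `y x z x` (same hypotheses). [folklore] -/
theorem fourLevel_yxzx_eq_zero (hxy : x * y = -(y * x)) (hxz : x * z = -(z * x))
    (hef : e + f = 1) (hyz : y * z * e = 0) (hxx : x * x * f = 0) : y * x * z * x = 0 := by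
  have h := fourLevel_yxxz_eq_zero x y z e f hxy hxz hef hyz hxx
  have hzx : z * x = -(x * z) := by rw [hxz, neg_neg]
  calc y * x * z * x = y * x * (z * x) := by noncomm_ring
    _ = y * x * (-(x * z)) := by rw [hzx]
    _ = -(y * x * x * z) := by noncomm_ring
    _ = 0 := by rw [h]; simp

/-- The ordering `y z x x` (same hypotheses). [folklore] -/
theorem fourLevel_yzxx_eq_zero (hxy : x * y = -(y * x)) (hxz : x * z = -(z * x))
    (hef : e + f = 1) (hyz : y * z * e = 0) (hxx : x * x * f = 0) : y * z * x * x = 0 := by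
  have h := fourLevel_yxzx_eq_zero x y z e f hxy hxz hef hyz hxx
  have hzx : z * x = -(x * z) := by rw [hxz, neg_neg]
  calc y * z * x * x = y * (z * x) * x := by noncomm_ring
    _ = y * (-(x * z)) * x := by rw [hzx]
    _ = -(y * x * z * x) := by noncomm_ring
    _ = 0 := by rw [h]; simp

end TwoUpTwoDown

section ThreeUpOneDown

variable {R : Type*} [Ring R] (x y e f : R)

/-- **Four-level vanishing, case `x x x y = 0`.** `x y = -y x`; `e + f = 1` with `y e = 0` (one down-step kills the
bottom level) and `x x x f = 0` (three up-steps kill all but the bottom level). [folklore] -/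
theorem fourLevel_xxxy_eq_zero (hxy : x * y = -(y * x)) (hef : e + f = 1) (hy : y * e = 0)
    (hx3 : x * x * x * f = 0) : x * x * x * y = 0 := by
  have hswap : x * x * x * y = -(y * (x * x * x)) := by
    calc x * x * x * y = x * x * (x * y) := by noncomm_ring
      _ = x * x * (-(y * x)) := by rw [hxy]
      _ = -(x * (x * y) * x) := by noncomm_ring
      _ = -(x * (-(y * x)) * x) := by rw [hxy]
      _ = (x * y) * x * x := by noncomm_ring
      _ = (-(y * x)) * x * x := by rw [hxy]
      _ = -(y * (x * x * x)) := by noncomm_ring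
  calc x * x * x * y = x * x * x * y * (e + f) := by rw [hef, mul_one]
    _ = x * x * x * (y * e) + (x * x * x * y) * f := by noncomm_ring
    _ = x * x * x * (y * e) - y * (x * x * x * f) := by rw [hswap]; noncomm_ring
    _ = 0 := by rw [hy, hx3]; simp

/-- The ordering `x x y x` (same hypotheses). [folklore] -/
theorem fourLevel_xxyx_eq_zero (hxy : x * y = -(y * x)) (hef : e + f = 1) (hy : y * e = 0)
    (hx3 : x * x * x * f = 0) : x * x * y * x = 0 := by
  have h := fourLevel_xxxy_eq_zero x y e f hxy hef hy hx3
  have hyx : y * x = -(x * y) := by rw [hxy, neg_neg]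
  calc x * x * y * x = x * x * (y * x) := by noncomm_ring
    _ = x * x * (-(x * y)) := by rw [hyx]
    _ = -(x * x * x * y) := by noncomm_ring
    _ = 0 := by rw [h]; simp

/-- The ordering `x y x x` (same hypotheses). [folklore] -/
theorem fourLevel_xyxx_eq_zero (hxy : x * y = -(y * x)) (hef : e + f = 1) (hy : y * e = 0)
    (hx3 : x * x * x * f = 0) : x * y * x * x = 0 := by
  have h := fourLevel_xxyx_eq_zero x y e f hxy hef hy hx3
  have hyx : y * x = -(x * y) := by rw [hxy, neg_neg]
  calc x * y * x * x = x * (y * x) * x := by noncomm_ring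
    _ = x * (-(x * y)) * x := by rw [hyx]
    _ = -(x * x * y * x) := by noncomm_ring
    _ = 0 := by rw [h]; simp

/-- The ordering `y x x x` (same hypotheses). [folklore] -/
theorem fourLevel_yxxx_eq_zero (hxy : x * y = -(y * x)) (hef : e + f = 1) (hy : y * e = 0)
    (hx3 : x * x * x * f = 0) : y * x * x * x = 0 := by
  have h := fourLevel_xyxx_eq_zero x y e f hxy hef hy hx3
  have hyx : y * x = -(x * y) := by rw [hxy, neg_neg]
  calc y * x * x * x = (y * x) * x * x := by noncomm_ring
    _ = (-(x * y)) * x * x := by rw [hyx]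
    _ = -(x * y * x * x) := by noncomm_ring
    _ = 0 := by rw [h]; simp

end ThreeUpOneDown

section OneUpThreeDown

variable {R : Type*} [Ring R] (x y z w e f : R)

/-- **Four-level vanishing, case `x y z w = 0`** for three conormal letters. `e + f = 1` with `y z w e = 0` (three
down-steps kill the bottom three levels) and `x f = 0` (`x` kills the top level). [folklore] -/
theorem fourLevel_xyzw_eq_zero (hxy : x * y = -(y * x)) (hxz : x * z = -(z * x)) (hxw : x * w = -(w * x))
    (hef : e + f = 1) (h3 : y * z * w * e = 0) (hx : x * f = 0) : x * y * z * w = 0 := by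
  have hswap : x * y * z * w = -(y * z * w * x) := by
    calc x * y * z * w = (x * y) * z * w := by noncomm_ring
      _ = (-(y * x)) * z * w := by rw [hxy]
      _ = -(y * (x * z) * w) := by noncomm_ring
      _ = -(y * (-(z * x)) * w) := by rw [hxz]
      _ = y * z * (x * w) := by noncomm_ring
      _ = y * z * (-(w * x)) := by rw [hxw]
      _ = -(y * z * w * x) := by noncomm_ring
  calc x * y * z * w = x * y * z * w * (e + f) := by rw [hef, mul_one]
    _ = x * (y * z * w * e) + (x * y * z * w) * f := by noncomm_ring
    _ = x * (y * z * w * e) - y * z * w * (x * f) := by rw [hswap]; noncomm_ring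
    _ = 0 := by rw [h3, hx]; simp

/-- The ordering `y z w x` (same hypotheses). [folklore] -/
theorem fourLevel_yzwx_eq_zero (hxy : x * y = -(y * x)) (hxz : x * z = -(z * x)) (hxw : x * w = -(w * x))
    (hef : e + f = 1) (h3 : y * z * w * e = 0) (hx : x * f = 0) : y * z * w * x = 0 := by
  have h := fourLevel_xyzw_eq_zero x y z w e f hxy hxz hxw hef h3 hx
  have hswap : y * z * w * x = -(x * y * z * w) := by
    calc y * z * w * x = y * z * (w * x) := by noncomm_ring
      _ = y * z * (-(x * w)) := by rw [hxw]; noncomm_ring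
      _ = -(y * (z * x) * w) := by noncomm_ring
      _ = -(y * (-(x * z)) * w) := by rw [hxz]; noncomm_ring
      _ = (y * x) * z * w := by noncomm_ring
      _ = (-(x * y)) * z * w := by rw [hxy]; noncomm_ring
      _ = -(x * y * z * w) := by noncomm_ring
  rw [hswap, h]; simp

end OneUpThreeDown

end Summit.Ventures.HSemireg
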